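import Mathlib
import HarnessLib
import Literature.NumberTheory.Irrationality.Zudilin2014.FirstTaleComplex
import Summits.KontsevichZagierPeriods.Zeta5Search.Denom.TwoTaleL25Forms
import Summits.KontsevichZagierPeriods.Zeta5Search.Denom.TwoTaleP15LineRep
import Summits.KontsevichZagierPeriods.Zeta5Search.TwoTaleRungADecay

/-!
# RUNG L(2/5) `(32,27,22,37 | 0,5,10,64)`: the line representation of `qₙ ζ(2) − pₙ`, and `DecayL25 c` from a line bound

HONEST FRAMING: systematic search; no irrationality claim unless certified.  Cell pub-zeta5 (measure-opt g0), the L(2/5)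
twin of P1's `TwoTaleD1LineRep` (file T1 of the D1 programme).  Nothing here is an irrationality or measure claim: this
file expresses the linear forms of the first-tale cone point `a = (32n+1, 27n+1, 22n+1, 37n+1)`,
`b = (1, 5n+1, 10n+1, 64n+2)` of [Zudilin2014ZetaTwo, §3] (rung `s = 2/5` of the two-tale ladder;
`Denom/TwoTaleL25Forms`: `formQL25`, `formPL25`, input `DecayL25`) as a vertical-line integral, exactly as
`TwoTaleL25LineRep` does at L(2/5), over the GENERAL Literature objects (`Zudilin2014.RC`, `coefC`, `coefA`, `formQ`,
`formP`, `RC_shift_eq`):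
* `ratRCL25 n s = RC (aL25 n) (bL25 n) s` and the line integral
  `lineIntegralL25 n x = (1/2π) ∫_ℝ (π/sin π(x+iy))² Rₙ(x − a₂* + iy) dy`, `a₂* = 27n+1`;
* `norm_lineIntegralL25_half_le` — on a half-integer line `|π/sin|² = π²/cosh²(πy)`;
* `ratRCL25_polar_newton` — eq. (P1)–(P3) of [Zudilin2014ZetaTwo, §3] at L(2/5) (tree `RC_shift_eq` with
  `a2starL25_eq`), poles indexed by `k ∈ [37n+1, 64n+2) ⊆ ℕ`;
* `lineIntegralL25_half_eq` — term-by-term evaluation on `Re t = ½` by fam-denom's `kernel_integral_expansion`;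
* **`lineRepL25_holds`**: `qₙ ζ(2) − pₙ = (−1)^d · lineIntegralL25 n ½` for every `n ≥ 1` (`d = dExp = 39n−1`);
* **`decayL25_of_lineBound`**: `DecayL25 c` from a strip shift to the lines `m + ½`, `m ≤ 22n`, and ONE eventual
  half-line bound `(π/2) ∫ |Rₙ(xₙ + ½ − a₂* + iy)|/cosh²(πy) dy ≤ e^{−cn}` (the strip shift is proved in
  `TwoTaleL25StripShift`, the bound in `TwoTaleL25Decay`).
References: W. Zudilin, arXiv:1310.1526 [Zudilin2014ZetaTwo] Prop. 1, Lemmas 1–2, §3.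
-/

noncomputable section

open Complex Set MeasureTheory Filter Topology Finset
open Literature.NumberTheory.Transcendental
open Literature.NumberTheory.Irrationality.Zudilin2014
open Summit.KontsevichZagierPeriods.Zeta5Search.Denom
open Summit.KontsevichZagierPeriods.Zeta5Search.Denom.TwoTaleL25Forms
open Summit.KontsevichZagierPeriods.Zeta5Search.Denom.TwoTaleP15Decay (kernelSq norm_kernelSq_half)
open Summit.KontsevichZagierPeriods.Zeta5Search.Denom.KernelBinomialMoment (barnesP)
open Summit.KontsevichZagierPeriods.Zeta5Search.Denom.KernelPolarMoment (add_natCast_ne_zero)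
open Summit.KontsevichZagierPeriods.Zeta5Search.Denom.TwoTaleP15LineRep
  (kernel_integral_expansion half_line_mem_halfStrip)
open Summit.KontsevichZagierPeriods.Zeta5Search.TwoTaleRungADecay (harmTwo_castC)

namespace Summit.KontsevichZagierPeriods.Zeta5Search.TwoTaleL25LineRep

/-! ### The objects -/

/-- The L(2/5) rational function over `ℂ`: `Rₙ(s) = RC (aL25 n) (bL25 n) s`
(`= Π · ∏(s+i)/∏(s+k)`, [Zudilin2014ZetaTwo, §3, eq. (gc)]). -/
def ratRCL25 (n : ℕ) (s : ℂ) : ℂ := RC (aL25 n) (bL25 n) s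

/-- The vertical-line integral `(1/2π) ∫_ℝ (π/sin π(x+iy))² Rₙ(x − a₂* + iy) dy`, `a₂* = 27n+1` — i.e.
`(1/2πi) ∫_{x−i∞}^{x+i∞} (π/sin πt)² Rₙ(t − a₂*) dt` with `t = x + iy`. -/
def lineIntegralL25 (n : ℕ) (x : ℝ) : ℂ :=
  (1 / (2 * Real.pi) : ℂ) *
    ∫ y : ℝ, kernelSq ((x : ℂ) + (y : ℂ) * I) * ratRCL25 n ((x : ℂ) - (27 * n + 1) + (y : ℂ) * I)

/-- **Norm bound on a half-integer line**: `|lineIntegralL25 n (m+½)| ≤ (π/2) ∫ |Rₙ(m + ½ − a₂* + iy)|/cosh²(πy) dy`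
(from `|π/sin π(m+½+iy)|² = π²/cosh²(πy)` and `‖∫‖ ≤ ∫‖·‖`). -/
theorem norm_lineIntegralL25_half_le (n m : ℕ) :
    ‖lineIntegralL25 n ((m : ℝ) + 1 / 2)‖ ≤ Real.pi / 2 *
      ∫ y : ℝ, ‖ratRCL25 n ((((m : ℝ) + 1 / 2 : ℝ) : ℂ) - (27 * n + 1) + (y : ℂ) * I)‖ /
        Real.cosh (Real.pi * y) ^ 2 := by
  unfold lineIntegralL25
  rw [norm_mul]
  have hnorm : ‖(1 / (2 * Real.pi) : ℂ)‖ = 1 / (2 * Real.pi) := by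
    rw [show (1 / (2 * Real.pi) : ℂ) = ((1 / (2 * Real.pi) : ℝ) : ℂ) by push_cast; ring, Complex.norm_real,
      Real.norm_eq_abs, abs_of_pos (by positivity)]
  rw [hnorm]
  have hint := norm_integral_le_integral_norm (μ := volume)
    (fun y : ℝ => kernelSq ((((m : ℝ) + 1 / 2 : ℝ) : ℂ) + (y : ℂ) * I) *
      ratRCL25 n ((((m : ℝ) + 1 / 2 : ℝ) : ℂ) - (27 * n + 1) + (y : ℂ) * I))
  have heq : (fun y : ℝ => ‖kernelSq ((((m : ℝ) + 1 / 2 : ℝ) : ℂ) + (y : ℂ) * I) *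
      ratRCL25 n ((((m : ℝ) + 1 / 2 : ℝ) : ℂ) - (27 * n + 1) + (y : ℂ) * I)‖) =
      fun y : ℝ => Real.pi ^ 2 * (‖ratRCL25 n ((((m : ℝ) + 1 / 2 : ℝ) : ℂ) - (27 * n + 1) + (y : ℂ) * I)‖ /
        Real.cosh (Real.pi * y) ^ 2) := by
    funext y
    rw [norm_mul, norm_kernelSq_half]
    ring
  rw [heq, integral_const_mul] at hint
  calc 1 / (2 * Real.pi) * ‖∫ y : ℝ, kernelSq ((((m : ℝ) + 1 / 2 : ℝ) : ℂ) + (y : ℂ) * I) *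
          ratRCL25 n ((((m : ℝ) + 1 / 2 : ℝ) : ℂ) - (27 * n + 1) + (y : ℂ) * I)‖
      ≤ 1 / (2 * Real.pi) * (Real.pi ^ 2 *
          ∫ y : ℝ, ‖ratRCL25 n ((((m : ℝ) + 1 / 2 : ℝ) : ℂ) - (27 * n + 1) + (y : ℂ) * I)‖ /
            Real.cosh (Real.pi * y) ^ 2) := by gcongr
    _ = Real.pi / 2 * ∫ y : ℝ, ‖ratRCL25 n ((((m : ℝ) + 1 / 2 : ℝ) : ℂ) - (27 * n + 1) + (y : ℂ) * I)‖ /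
          Real.cosh (Real.pi * y) ^ 2 := by
      rw [← mul_assoc]
      congr 1
      field_simp

/-! ### Partial fractions and Newton expansion at L(2/5) -/

/-- On a line: `s − a₂* + k = s + (k − a₂*)` with `k − a₂* : ℕ` once `k ≥ 37n+1 > a₂* = 27n+1`. -/
theorem line_shift_eqL25 (n k : ℕ) (hk : 37 * n + 1 ≤ k) (s : ℂ) :
    s - (27 * n + 1) + k = s + ((k - (27 * n + 1) : ℕ) : ℂ) := by
  rw [Nat.cast_sub (by omega)]
  push_cast
  ring

/-- On the line `Re t = ½` no shifted pole is met: `(½ + iy) − a₂* + k ≠ 0` for `37n+1 ≤ k`. -/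
theorem line_shift_ne_zeroL25 (n : ℕ) (y : ℝ) :
    ∀ k ∈ Finset.Ico (37 * n + 1) (64 * n + 2), (((1 / 2 : ℝ) : ℂ) + (y : ℂ) * I) - (27 * n + 1) + k ≠ 0 := by
  intro k hk
  rw [line_shift_eqL25 n k (Finset.mem_Ico.1 hk).1]
  exact add_natCast_ne_zero le_rfl (half_line_mem_halfStrip y)

/-- The polar index set of L(2/5) as the image of `[37n+1, 64n+2) ⊆ ℕ`. -/
theorem IcoL25_eq_map (n : ℕ) :
    Finset.Ico (aL25 n 3) (bL25 n 3) = (Finset.Ico (37 * n + 1) (64 * n + 2)).map Nat.castEmbedding := by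
  have e1 : (37 * (n : ℤ) + 1) = ((37 * n + 1 : ℕ) : ℤ) := by push_cast; ring
  have e2 : (64 * (n : ℤ) + 2) = ((64 * n + 2 : ℕ) : ℤ) := by push_cast; ring
  rw [aL25_three, bL25_three, e1, e2, TwoTaleP15Bridge.Ico_natCast_eq_map]

/-- The summation range of `formQ`/`formP` at L(2/5) (`a₄* = amax = 37n+1 = a₄`) as the same image. -/
theorem IcoL25_amax_eq_map (n : ℕ) :
    Finset.Ico (amax (aL25 n)) (bL25 n 3) = (Finset.Ico (37 * n + 1) (64 * n + 2)).map Nat.castEmbedding := by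
  rw [amaxL25_eq, ← IcoL25_eq_map, aL25_three]

/-- `a₂*` at L(2/5), cast to `ℂ`. -/
theorem a2starL25_castC (n : ℕ) : ((a2star (aL25 n) : ℤ) : ℂ) = 27 * n + 1 := by
  rw [a2starL25_eq]; push_cast; ring

/-- **Eq. (P1)–(P3) at L(2/5)** ([Zudilin2014ZetaTwo, §3], tree `Zudilin2014.RC_shift_eq`): off the poles,
`Rₙ(t − a₂*) = Σ_{k=37n+1}^{64n+1} C_k/(t − a₂* + k) + Σ_{l ≤ d} A_l · P_l(t)`, `P_l(t) = (t−1)⋯(t−l)/l!`. -/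
theorem ratRCL25_polar_newton {n : ℕ} (hn : 1 ≤ n) (t : ℂ)
    (ht : ∀ k ∈ Finset.Ico (37 * n + 1) (64 * n + 2), t - (27 * n + 1) + k ≠ 0) :
    ratRCL25 n (t - (27 * n + 1)) =
      ∑ k ∈ Finset.Ico (37 * n + 1) (64 * n + 2),
          ((coefC (aL25 n) (bL25 n) (k : ℤ) : ℚ) : ℂ) / (t - (27 * n + 1) + k) +
        ∑ l ∈ Finset.range (dExp (aL25 n) (bL25 n) + 1),
          ((coefA (aL25 n) (bL25 n) l : ℚ) : ℂ) * barnesP l t := by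
  have htZ : ∀ k ∈ Finset.Ico (aL25 n 3) (bL25 n 3), t - (a2star (aL25 n) : ℂ) + (k : ℂ) ≠ 0 := by
    intro k hk
    rw [IcoL25_eq_map, Finset.mem_map] at hk
    obtain ⟨m, hm, rfl⟩ := hk
    rw [a2starL25_castC, Nat.castEmbedding_apply, Int.cast_natCast]
    exact ht m hm
  have h := RC_shift_eq (admissibleL25 hn) t htZ
  rw [a2starL25_castC] at h
  unfold ratRCL25
  rw [h, IcoL25_eq_map, Finset.sum_map]
  congr 1

/-! ### The line representation at L(2/5) -/

/-- **The line integral at `x = ½`, evaluated term by term**: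
`(1/2π) ∫_ℝ (π/sin π(½+iy))² Rₙ(½ − a₂* + iy) dy = Σ_k C_k (ζ(2) − Σ_{i ≤ k−a₂*} i⁻²) + Σ_l A_l (−1)^l/(l+1)`. -/
theorem lineIntegralL25_half_eq {n : ℕ} (hn : 1 ≤ n) :
    lineIntegralL25 n (1 / 2) =
      ∑ k ∈ Ico (37 * n + 1) (64 * n + 2), ((coefC (aL25 n) (bL25 n) (k : ℤ) : ℚ) : ℂ) *
          (((zetaValue 2 - ∑ i ∈ range (k - (27 * n + 1) + 1), (1 : ℝ) / (i : ℝ) ^ 2 : ℝ) : ℂ)) +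
        ∑ l ∈ range (dExp (aL25 n) (bL25 n) + 1),
          ((coefA (aL25 n) (bL25 n) l : ℚ) : ℂ) * ((-1) ^ l / (l + 1)) := by
  have hfun : (fun y : ℝ => kernelSq (((1 / 2 : ℝ) : ℂ) + (y : ℂ) * I) *
        ratRCL25 n (((1 / 2 : ℝ) : ℂ) - (27 * n + 1) + (y : ℂ) * I)) =
      fun y : ℝ => kernelSq (((1 / 2 : ℝ) : ℂ) + (y : ℂ) * I) *
        (∑ k ∈ Ico (37 * n + 1) (64 * n + 2),
            ((coefC (aL25 n) (bL25 n) (k : ℤ) : ℚ) : ℂ) /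
              ((((1 / 2 : ℝ) : ℂ) + (y : ℂ) * I) + ((k - (27 * n + 1) : ℕ) : ℂ)) +
          ∑ l ∈ range (dExp (aL25 n) (bL25 n) + 1),
            ((coefA (aL25 n) (bL25 n) l : ℚ) : ℂ) * barnesP l (((1 / 2 : ℝ) : ℂ) + (y : ℂ) * I)) := by
    funext y
    have harg : ((1 / 2 : ℝ) : ℂ) - (27 * n + 1) + (y : ℂ) * I =
        (((1 / 2 : ℝ) : ℂ) + (y : ℂ) * I) - (27 * n + 1) := by
      ring
    rw [harg, ratRCL25_polar_newton hn _ (line_shift_ne_zeroL25 n y)]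
    congr 2
    refine sum_congr rfl fun k hk => ?_
    rw [line_shift_eqL25 n k (Finset.mem_Ico.1 hk).1]
  unfold lineIntegralL25
  rw [hfun]
  exact kernel_integral_expansion (Ico (37 * n + 1) (64 * n + 2)) (range (dExp (aL25 n) (bL25 n) + 1))
    (fun k => k - (27 * n + 1)) (fun k => ((coefC (aL25 n) (bL25 n) (k : ℤ) : ℚ) : ℂ))
    (fun l => ((coefA (aL25 n) (bL25 n) l : ℚ) : ℂ))

/-- `qₙ` through the Literature's rational form: `(formQL25 n : ℂ) = (−1)^d Σ_{k ∈ [37n+1,64n+2)} C_k`. -/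
theorem formQL25_castC {n : ℕ} (hn : 1 ≤ n) :
    ((formQL25 n : ℤ) : ℂ) = (-1) ^ dExp (aL25 n) (bL25 n) *
      ∑ k ∈ Ico (37 * n + 1) (64 * n + 2), ((coefC (aL25 n) (bL25 n) (k : ℤ) : ℚ) : ℂ) := by
  have h1 : ((formQL25 n : ℤ) : ℂ) = ((formQ (aL25 n) (bL25 n) : ℚ) : ℂ) := by
    rw [← formQL25_cast hn]; push_cast; rfl
  rw [h1, formQ, IcoL25_amax_eq_map, Finset.sum_map]
  push_cast
  rfl

/-- `pₙ` through the Literature's definition: `(formPL25 n : ℂ) = (−1)^d (Σ_k C_k H₂(k − a₂*) − Σ_l (−1)^l A_l/(l+1))`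
with `H₂` expanded as a `range` sum. -/
theorem formPL25_castC (n : ℕ) :
    ((formPL25 n : ℚ) : ℂ) = (-1) ^ dExp (aL25 n) (bL25 n) *
      (∑ k ∈ Ico (37 * n + 1) (64 * n + 2), ((coefC (aL25 n) (bL25 n) (k : ℤ) : ℚ) : ℂ) *
          ∑ i ∈ range (k - (27 * n + 1) + 1), (1 : ℂ) / (i : ℂ) ^ 2 -
        ∑ l ∈ range (dExp (aL25 n) (bL25 n) + 1),
          (-1) ^ l * ((coefA (aL25 n) (bL25 n) l : ℚ) : ℂ) / (l + 1)) := by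
  have hsum : ∑ k ∈ Ico (amax (aL25 n)) (bL25 n 3),
      coefC (aL25 n) (bL25 n) k * harmTwo (k - a2star (aL25 n)).toNat =
      ∑ k ∈ Ico (37 * n + 1) (64 * n + 2),
        coefC (aL25 n) (bL25 n) (k : ℤ) * harmTwo (k - (27 * n + 1)) := by
    rw [IcoL25_amax_eq_map, Finset.sum_map]
    refine Finset.sum_congr rfl fun m hm => ?_
    have hm1 := (Finset.mem_Ico.1 hm).1
    have ht : (((m : ℕ) : ℤ) - a2star (aL25 n)).toNat = m - (27 * n + 1) := by
      rw [a2starL25_eq]; omega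
    rw [Nat.castEmbedding_apply, ht]
  unfold formPL25 formP
  rw [hsum]
  push_cast
  simp only [harmTwo_castC]

/-- **The line representation IS A THEOREM at L(2/5)** ([Zudilin2014ZetaTwo, Prop. 1, (P4)–(P5)]: (P1)–(P3) +
linearity + Lemmas 1–2 in kernel form): `qₙ ζ(2) − pₙ = (−1)^d (1/2π) ∫_ℝ (π/sin π(½+iy))² Rₙ(½ − a₂* + iy) dy`
for every `n ≥ 1`. -/
theorem lineRepL25_holds {n : ℕ} (hn : 1 ≤ n) :
    ((formQL25 n : ℤ) : ℂ) * ((zetaValue 2 : ℝ) : ℂ) - ((formPL25 n : ℚ) : ℂ) =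
      (-1) ^ dExp (aL25 n) (bL25 n) * lineIntegralL25 n (1 / 2) := by
  have hU : ∑ l ∈ range (dExp (aL25 n) (bL25 n) + 1),
      ((coefA (aL25 n) (bL25 n) l : ℚ) : ℂ) * ((-1) ^ l / (l + 1)) =
      ∑ l ∈ range (dExp (aL25 n) (bL25 n) + 1),
        (-1) ^ l * ((coefA (aL25 n) (bL25 n) l : ℚ) : ℂ) / (l + 1) :=
    sum_congr rfl fun l _ => by ring
  rw [lineIntegralL25_half_eq hn, hU, formQL25_castC hn, formPL25_castC n]
  push_cast
  simp only [mul_sub, sum_sub_distrib, ← sum_mul]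
  ring

/-! ### `DecayL25 c` from a strip shift and one line bound -/

/-- **`DecayL25 c` from the pieces**: the line representation (proved above), a strip shift to the half-integer
lines `m + ½`, `m ≤ 13n` (hypothesis; proved in `TwoTaleL25StripShift`), and an eventual bound on ONE line
`xₙ + ½`, `xₙ ≤ 13n`. -/
theorem decayL25_of_lineBound {c : ℝ}
    (hShift : ∀ n : ℕ, 1 ≤ n → ∀ m : ℕ, m ≤ 22 * n → lineIntegralL25 n ((m : ℝ) + 1 / 2) = lineIntegralL25 n (1 / 2))
    (x : ℕ → ℕ) (hx : ∀ n, x n ≤ 22 * n)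
    (hB : ∀ᶠ n : ℕ in atTop, Real.pi / 2 *
      ∫ y : ℝ, ‖ratRCL25 n ((((x n : ℝ) + 1 / 2 : ℝ) : ℂ) - (27 * n + 1) + (y : ℂ) * I)‖ /
        Real.cosh (Real.pi * y) ^ 2 ≤ Real.exp (-(c * n))) :
    DecayL25 c := by
  unfold DecayL25
  filter_upwards [hB, eventually_ge_atTop 1] with n hn h1
  have hc : (((formQL25 n : ℝ) * zetaValue 2 - (formPL25 n : ℝ) : ℝ) : ℂ) =
      (-1) ^ dExp (aL25 n) (bL25 n) * lineIntegralL25 n (1 / 2) := by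
    rw [← lineRepL25_holds h1]
    push_cast
    ring
  calc |(formQL25 n : ℝ) * zetaValue 2 - (formPL25 n : ℝ)|
      = ‖(((formQL25 n : ℝ) * zetaValue 2 - (formPL25 n : ℝ) : ℝ) : ℂ)‖ := by
        rw [Complex.norm_real, Real.norm_eq_abs]
    _ = ‖lineIntegralL25 n ((x n : ℝ) + 1 / 2)‖ := by
        rw [hc, norm_mul, norm_pow, norm_neg, norm_one, one_pow, one_mul, hShift n h1 (x n) (hx n)]
    _ ≤ _ := norm_lineIntegralL25_half_le n (x n)
    _ ≤ Real.exp (-(c * n)) := hn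

end Summit.KontsevichZagierPeriods.Zeta5Search.TwoTaleL25LineRep

end
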